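import Literature.Analysis.FluidPDE.SelfSimilarEulerProfile
import Literature.Analysis.FluidPDE.SelfSimilarEulerOutgoingExclusionTools
import HarnessLib

/-!
# Trapped trajectories of the self-similar Lagrangian flow come to rest at stagnation points
# (Constantin–Ignatova–Vicol 2026, §3.4.3: the Bernoulli function as a Lyapunov function)

Analysis/FluidPDE proof file (theorems only; no definitions, no named facts, no `sorry`).

P. Constantin, M. Ignatova, V. Vicol, *On putative self-similarity for incompressible 3D Euler*
(arXiv:2602.17570), §3.4.3 (3.30)–(3.33): for a self-similar Euler profile `(U, P)` with exponent `γ` the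
self-similar Bernoulli function `ℋ = ½|V|² + P + ½γ(γ−1)|y − c|²`, `V = γ(y − c) + U` (tree
`selfSimilarBernoulli`, `selfSimilarTransport`) satisfies `V·∇ℋ = (2γ − 1)|V|²` ((3.31); tree
`IsSelfSimilarEulerProfile.fderiv_selfSimilarBernoulli_transport`), "which vanishes only on the nodal set
`𝒩_V`" ((3.33)); CIV use its sign to confine backward trajectories (`γ < ½`) and, in Remark 3.6 / §4, point at
the fixed points of the flow and their stable manifolds as the organising objects.  This file records the
dynamical content of (3.31) for TRAPPED trajectories, with no symmetry and no decay hypothesis: along a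
solution `Y' = σ V(Y)` (`σ ≠ 0` a constant time orientation; `σ = −1` gives backward trajectories) the
function `ℋ ∘ Y` is monotone with derivative `σ(2γ−1)|V(Y)|²`, so on a bounded half-trajectory the "speed"
`|V(Y(t))|` is square-integrable in time and, being uniformly continuous, tends to zero:

* `IsSelfSimilarEulerProfile.hasDerivAt_bernoulli_comp` — `d/dt ℋ(Y(t)) = σ(2γ−1)|V(Y(t))|²`;
* `IsSelfSimilarEulerProfile.bernoulli_comp_sub_eq` — `ℋ(Y(b)) − ℋ(Y(a)) = σ(2γ−1)∫_a^b |V(Y)|²`;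
* `IsSelfSimilarEulerProfile.tendsto_transport_comp_of_bounded` — **for `γ ≠ ½`, along every trajectory
  that stays in a bounded set for `t ≥ 0`, `V(Y(t)) → 0` as `t → ∞`** (Barbalat's argument);
* `IsSelfSimilarEulerProfile.exists_mem_nodalSet_mapClusterPt_of_bounded` — hence such a trajectory
  ACCUMULATES AT A STAGNATION POINT: some `y ∈ 𝒩_V` is a cluster point of `Y(t)`, `t → ∞`.  With `σ = −1`:
  in the window `γ < ½`, where backward trajectories are the bounded ones (CIV §3.4.3), every backward
  trajectory EMANATES from the nodal set.  KILL-TEST reading for candidate refuting profiles of the crux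
  `NavierStokesRegularity/EulerZoomLiouville.PowerGaugeEulerLiouville` (stmt-NavierStokesRegularity-19832):
  a recirculation region of `γy + U` whose closure contains no stagnation point is impossible — «no
  recirculation without stagnation» (the closed-orbit case is `SelfSimilarEulerClosedOrbit.lean`).

Scope: `C²`/`C¹` regularity is that of `IsSelfSimilarEulerProfile`; nothing here concerns existence of
profiles or Navier–Stokes.
-/

noncomputable section

open Set Filter Topology InnerProductSpace Metric MeasureTheory
open scoped RealInnerProductSpace Interval

namespace Literature.Analysis.FluidPDE

namespace IsSelfSimilarEulerProfile

variable {γ : ℝ} {c : EuclideanSpace ℝ (Fin 3)}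
  {U : EuclideanSpace ℝ (Fin 3) → EuclideanSpace ℝ (Fin 3)} {P : EuclideanSpace ℝ (Fin 3) → ℝ}

/-- The transport field `V = γ(y − c) + U` of a profile is continuous. [folklore] -/
private theorem continuous_transport (h : IsSelfSimilarEulerProfile γ c U P) :
    Continuous (selfSimilarTransport γ c U) := by
  have e : selfSimilarTransport γ c U = fun y => γ • (y - c) + U y := rfl
  rw [e]
  exact ((continuous_id.sub continuous_const).const_smul γ).add h.contDiff_velocity.continuous

/-- **`ℋ` along a trajectory.** For a profile and a solution of `Y' = σ V(Y)`,
`d/dt ℋ(Y(t)) = σ (2γ − 1)|V(Y(t))|²` (CIV (3.31) composed with the chain rule).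
[cite: ConstantinIgnatovaVicol2026Putative, §3.4.3 eq. (3.31)] -/
theorem hasDerivAt_bernoulli_comp (h : IsSelfSimilarEulerProfile γ c U P) {σ : ℝ}
    {Y : ℝ → EuclideanSpace ℝ (Fin 3)} (hY : ∀ t, HasDerivAt Y (σ • selfSimilarTransport γ c U (Y t)) t)
    (t : ℝ) :
    HasDerivAt (fun s => selfSimilarBernoulli γ c U P (Y s))
      (σ * ((2 * γ - 1) * ‖selfSimilarTransport γ c U (Y t)‖ ^ 2)) t := by
  have hHd : Differentiable ℝ (selfSimilarBernoulli γ c U P) :=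
    (contDiff_selfSimilarBernoulli h).differentiable one_ne_zero
  have h1 : HasDerivAt (fun s => selfSimilarBernoulli γ c U P (Y s))
      (fderiv ℝ (selfSimilarBernoulli γ c U P) (Y t) (σ • selfSimilarTransport γ c U (Y t))) t :=
    (hHd (Y t)).hasFDerivAt.comp_hasDerivAt t (hY t)
  rw [map_smul, h.fderiv_selfSimilarBernoulli_transport (Y t), smul_eq_mul] at h1
  exact h1

/-- **The speed-square integral along a trajectory** (`a ≤ b`):
`ℋ(Y(b)) − ℋ(Y(a)) = σ(2γ−1) ∫_a^b |V(Y(t))|² dt`. [cite: ConstantinIgnatovaVicol2026Putative, §3.4.3 eq. (3.31)] -/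
theorem bernoulli_comp_sub_eq (h : IsSelfSimilarEulerProfile γ c U P) {σ : ℝ}
    {Y : ℝ → EuclideanSpace ℝ (Fin 3)} (hY : ∀ t, HasDerivAt Y (σ • selfSimilarTransport γ c U (Y t)) t)
    (a b : ℝ) :
    selfSimilarBernoulli γ c U P (Y b) - selfSimilarBernoulli γ c U P (Y a) =
      σ * (2 * γ - 1) * ∫ t in a..b, ‖selfSimilarTransport γ c U (Y t)‖ ^ 2 := by
  have hYc : Continuous Y := continuous_iff_continuousAt.2 fun t => (hY t).continuousAt
  have hgc : Continuous fun t => σ * ((2 * γ - 1) * ‖selfSimilarTransport γ c U (Y t)‖ ^ 2) :=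
    continuous_const.mul (continuous_const.mul (((continuous_transport h).comp hYc).norm.pow 2))
  have key := intervalIntegral.integral_eq_sub_of_hasDerivAt
    (fun t _ => h.hasDerivAt_bernoulli_comp hY t) (hgc.intervalIntegrable a b)
  rw [← key, intervalIntegral.integral_const_mul, intervalIntegral.integral_const_mul, mul_assoc]

/-- **Bounded half-trajectories have square-integrable speed** (`γ ≠ ½`, `σ ≠ 0`): if `‖Y(t)‖ ≤ B` for
`t ≥ 0`, then `∫_a^b |V(Y)|² ≤ 2 sup_{B̄_B}|ℋ| / |σ(2γ−1)|` for all `0 ≤ a ≤ b`.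
[cite: ConstantinIgnatovaVicol2026Putative, §3.4.3 eq. (3.31)–(3.33)] -/
theorem exists_integral_norm_transport_sq_le (h : IsSelfSimilarEulerProfile γ c U P) (hγ : γ ≠ 1 / 2)
    {σ : ℝ} (hσ : σ ≠ 0) {Y : ℝ → EuclideanSpace ℝ (Fin 3)}
    (hY : ∀ t, HasDerivAt Y (σ • selfSimilarTransport γ c U (Y t)) t) {B : ℝ} (hB : ∀ t, 0 ≤ t → ‖Y t‖ ≤ B) :
    ∃ C : ℝ, ∀ a b : ℝ, 0 ≤ a → a ≤ b → ∫ t in a..b, ‖selfSimilarTransport γ c U (Y t)‖ ^ 2 ≤ C := by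
  obtain ⟨M, hM⟩ := (isCompact_closedBall (0 : EuclideanSpace ℝ (Fin 3)) B).exists_bound_of_continuousOn
    (contDiff_selfSimilarBernoulli h).continuous.continuousOn
  have hκ : σ * (2 * γ - 1) ≠ 0 := mul_ne_zero hσ (by intro h0; apply hγ; linarith)
  refine ⟨2 * M / |σ * (2 * γ - 1)|, fun a b ha hab => ?_⟩
  have e := h.bernoulli_comp_sub_eq hY a b
  have hMa : ‖selfSimilarBernoulli γ c U P (Y a)‖ ≤ M := hM _ (mem_closedBall_zero_iff.2 (hB a ha))
  have hMb : ‖selfSimilarBernoulli γ c U P (Y b)‖ ≤ M := hM _ (mem_closedBall_zero_iff.2 (hB b (ha.trans hab)))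
  have h1 : |σ * (2 * γ - 1) * ∫ t in a..b, ‖selfSimilarTransport γ c U (Y t)‖ ^ 2| ≤ 2 * M := by
    rw [← e]
    rw [Real.norm_eq_abs] at hMa hMb
    calc |selfSimilarBernoulli γ c U P (Y b) - selfSimilarBernoulli γ c U P (Y a)|
        ≤ |selfSimilarBernoulli γ c U P (Y b)| + |selfSimilarBernoulli γ c U P (Y a)| := abs_sub _ _
      _ ≤ M + M := add_le_add hMb hMa
      _ = 2 * M := by ring
  rw [abs_mul] at h1
  have hpos : 0 < |σ * (2 * γ - 1)| := abs_pos.2 hκ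
  rw [le_div_iff₀ hpos]
  calc (∫ t in a..b, ‖selfSimilarTransport γ c U (Y t)‖ ^ 2) * |σ * (2 * γ - 1)|
      ≤ |∫ t in a..b, ‖selfSimilarTransport γ c U (Y t)‖ ^ 2| * |σ * (2 * γ - 1)| :=
        mul_le_mul_of_nonneg_right (le_abs_self _) hpos.le
    _ = |σ * (2 * γ - 1)| * |∫ t in a..b, ‖selfSimilarTransport γ c U (Y t)‖ ^ 2| := mul_comm _ _
    _ ≤ 2 * M := h1

/-- **Trapped trajectories come to rest (`γ ≠ ½`).**  Let `(U, P)` be a self-similar Euler profile with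
`γ ≠ ½` and `Y` a solution of `Y' = σ V(Y)` (`σ ≠ 0`; `σ = −1` for backward trajectories of `V`) which stays in
the ball `‖Y(t)‖ ≤ B` for `t ≥ 0`.  Then `V(Y(t)) → 0` as `t → ∞`.  Proof (Barbalat): `t ↦ |V(Y(t))|` is
Lipschitz (`Y'` bounded, `V` Lipschitz on the ball) and square-integrable on `[0, ∞)` by
`exists_integral_norm_transport_sq_le`; a Lipschitz function that is `≥ ε` at arbitrarily late times has
speed-square integral `≥ δε²/4` on arbitrarily late windows, contradicting the Cauchy property of
`T ↦ ∫_0^T |V(Y)|²`. [cite: ConstantinIgnatovaVicol2026Putative, §3.4.3 eq. (3.31)–(3.33) and Rem. 3.6] -/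
theorem tendsto_transport_comp_of_bounded (h : IsSelfSimilarEulerProfile γ c U P) (hγ : γ ≠ 1 / 2)
    {σ : ℝ} (hσ : σ ≠ 0) {Y : ℝ → EuclideanSpace ℝ (Fin 3)}
    (hY : ∀ t, HasDerivAt Y (σ • selfSimilarTransport γ c U (Y t)) t) {B : ℝ} (hB : ∀ t, 0 ≤ t → ‖Y t‖ ≤ B) :
    Tendsto (fun t => selfSimilarTransport γ c U (Y t)) atTop (𝓝 0) := by
  have hVc := continuous_transport h
  have hYc : Continuous Y := continuous_iff_continuousAt.2 fun t => (hY t).continuousAt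
  set g : ℝ → ℝ := fun t => ‖selfSimilarTransport γ c U (Y t)‖ with hg
  have hgc : Continuous g := (hVc.comp hYc).norm
  -- bounds on the ball: speed `S`, Lipschitz constant `L` of `U`
  obtain ⟨S, hS⟩ := (isCompact_closedBall (0 : EuclideanSpace ℝ (Fin 3)) B).exists_bound_of_continuousOn
    hVc.continuousOn
  obtain ⟨L, hL⟩ := (isCompact_closedBall (0 : EuclideanSpace ℝ (Fin 3)) B).exists_bound_of_continuousOn
    ((h.contDiff_velocity.continuous_fderiv (by norm_num)).continuousOn)
  have hS0 : 0 ≤ S := (norm_nonneg _).trans (hS (Y 0) (mem_closedBall_zero_iff.2 (hB 0 le_rfl)))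
  have hL0 : 0 ≤ L := (norm_nonneg _).trans (hL (Y 0) (mem_closedBall_zero_iff.2 (hB 0 le_rfl)))
  -- `Y` is `|σ| S`-Lipschitz on `[0, ∞)`
  have hYlip : ∀ s t : ℝ, 0 ≤ s → s ≤ t → ‖Y t - Y s‖ ≤ |σ| * S * (t - s) := by
    intro s t hs hst
    have key := Convex.norm_image_sub_le_of_norm_hasDerivWithin_le (f := Y) (s := Ici (0 : ℝ))
      (C := |σ| * S) (fun x _ => (hY x).hasDerivWithinAt) (fun x hx => ?_) (convex_Ici 0) (mem_Ici.2 hs)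
      (mem_Ici.2 (hs.trans hst))
    · rw [Real.norm_eq_abs, abs_of_nonneg (sub_nonneg.2 hst)] at key
      exact key
    · rw [norm_smul, Real.norm_eq_abs]
      exact mul_le_mul_of_nonneg_left (hS _ (mem_closedBall_zero_iff.2 (hB x hx))) (abs_nonneg _)
  -- `V` is `(|γ| + L)`-Lipschitz on the ball
  have hVlip : ∀ x y : EuclideanSpace ℝ (Fin 3), ‖x‖ ≤ B → ‖y‖ ≤ B →
      ‖selfSimilarTransport γ c U y - selfSimilarTransport γ c U x‖ ≤ (|γ| + L) * ‖y - x‖ := by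
    intro x y hx hy
    have hU : ‖U y - U x‖ ≤ L * ‖y - x‖ :=
      Convex.norm_image_sub_le_of_norm_fderiv_le (fun z _ => h.differentiable_velocity z)
        (fun z hz => hL z hz) (convex_closedBall 0 B) (mem_closedBall_zero_iff.2 hx)
        (mem_closedBall_zero_iff.2 hy)
    have e : selfSimilarTransport γ c U y - selfSimilarTransport γ c U x = γ • (y - x) + (U y - U x) := by
      simp only [selfSimilarTransport_apply, smul_sub]
      abel
    rw [e]
    calc ‖γ • (y - x) + (U y - U x)‖ ≤ ‖γ • (y - x)‖ + ‖U y - U x‖ := norm_add_le _ _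
      _ ≤ |γ| * ‖y - x‖ + L * ‖y - x‖ := by
          rw [norm_smul, Real.norm_eq_abs]
          exact add_le_add le_rfl hU
      _ = (|γ| + L) * ‖y - x‖ := by ring
  -- hence `g` is Lipschitz in time on `[0, ∞)` with constant `Λ = (|γ| + L) |σ| S`
  set Λ : ℝ := (|γ| + L) * (|σ| * S) with hΛ
  have hΛ0 : 0 ≤ Λ := by positivity
  have hglip : ∀ s t : ℝ, 0 ≤ s → s ≤ t → |g t - g s| ≤ Λ * (t - s) := by
    intro s t hs hst
    calc |g t - g s| ≤ ‖selfSimilarTransport γ c U (Y t) - selfSimilarTransport γ c U (Y s)‖ :=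
          abs_norm_sub_norm_le _ _
      _ ≤ (|γ| + L) * ‖Y t - Y s‖ := hVlip _ _ (hB s hs) (hB t (hs.trans hst))
      _ ≤ (|γ| + L) * (|σ| * S * (t - s)) := mul_le_mul_of_nonneg_left (hYlip s t hs hst) (by positivity)
      _ = Λ * (t - s) := by rw [hΛ]; ring
  -- the speed-square integral `I(T) = ∫_0^T g²` is nondecreasing and bounded, hence Cauchy
  obtain ⟨C, hC⟩ := h.exists_integral_norm_transport_sq_le hγ hσ hY hB
  set I : ℝ → ℝ := fun T => ∫ t in (0 : ℝ)..T, g t ^ 2 with hI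
  have hgi : ∀ a b : ℝ, IntervalIntegrable (fun t => g t ^ 2) volume a b :=
    fun a b => (hgc.pow 2).intervalIntegrable a b
  have hImono : Monotone fun T : ℝ => I (max T 0) := by
    intro T₁ T₂ h12
    have hm : max T₁ 0 ≤ max T₂ 0 := max_le_max h12 le_rfl
    show I (max T₁ 0) ≤ I (max T₂ 0)
    rw [hI]
    simp only
    rw [← intervalIntegral.integral_add_adjacent_intervals (hgi 0 (max T₁ 0)) (hgi (max T₁ 0) (max T₂ 0))]
    have : 0 ≤ ∫ t in max T₁ 0..max T₂ 0, g t ^ 2 :=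
      intervalIntegral.integral_nonneg hm fun t _ => sq_nonneg _
    linarith
  have hIbdd : BddAbove (range fun T : ℝ => I (max T 0)) := by
    refine ⟨C, ?_⟩
    rintro _ ⟨T, rfl⟩
    exact hC 0 (max T 0) le_rfl (le_max_right _ _)
  have hIlim : Tendsto (fun T : ℝ => I (max T 0)) atTop (𝓝 (⨆ T : ℝ, I (max T 0))) :=
    tendsto_atTop_ciSup hImono hIbdd
  -- Barbalat: `g → 0`
  rw [tendsto_zero_iff_norm_tendsto_zero]
  change Tendsto g atTop (𝓝 0)
  rw [Metric.tendsto_atTop]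
  intro ε hε
  by_contra hcon
  push Not at hcon
  -- window length `δ` with `Λ δ ≤ ε/2`
  obtain ⟨δ, hδ0, hδ⟩ : ∃ δ : ℝ, 0 < δ ∧ Λ * δ ≤ ε / 2 := by
    by_cases hΛz : Λ = 0
    · exact ⟨1, one_pos, by rw [hΛz, zero_mul]; linarith⟩
    · have hΛp : 0 < Λ := lt_of_le_of_ne hΛ0 (Ne.symm hΛz)
      refine ⟨ε / 2 / Λ, by positivity, ?_⟩
      rw [mul_div_cancel₀ _ hΛz]
  have hη : 0 < δ * (ε / 2) ^ 2 := by positivity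
  -- Cauchy window for `I`
  have hcau := (Metric.tendsto_atTop.1 hIlim) (δ * (ε / 2) ^ 2 / 2) (by positivity)
  obtain ⟨N, hN⟩ := hcau
  obtain ⟨t, htN, hgt⟩ := hcon (max N 0)
  have ht0 : 0 ≤ t := (le_max_right _ _).trans htN
  have htN' : N ≤ t := (le_max_left _ _).trans htN
  -- `g ≥ ε/2` on `[t, t + δ]`
  have hge : ∀ s ∈ Icc t (t + δ), ε / 2 ≤ g s := by
    intro s hs
    have h1 := hglip t s ht0 hs.1
    have h2 : Λ * (s - t) ≤ ε / 2 := (mul_le_mul_of_nonneg_left (by linarith [hs.2]) hΛ0).trans hδ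
    have h3 : dist (g t) 0 = g t := by rw [dist_zero_right, Real.norm_eq_abs, abs_of_nonneg (norm_nonneg _)]
    have hgt' : ε ≤ g t := by rw [← h3]; exact hgt
    have h4 : g t - g s ≤ ε / 2 := ((le_abs_self _).trans (by rw [abs_sub_comm]; exact h1)).trans h2
    linarith
  -- so `I(t+δ) − I(t) ≥ δ (ε/2)²`
  have hlow : δ * (ε / 2) ^ 2 ≤ I (t + δ) - I t := by
    have e : I (t + δ) - I t = ∫ s in t..t + δ, g s ^ 2 := by
      rw [hI]
      simp only
      rw [← intervalIntegral.integral_add_adjacent_intervals (hgi 0 t) (hgi t (t + δ))]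
      ring
    rw [e]
    have h1 : ∫ s in t..t + δ, (ε / 2) ^ 2 ≤ ∫ s in t..t + δ, g s ^ 2 :=
      intervalIntegral.integral_mono_on (by linarith) (intervalIntegrable_const) (hgi t (t + δ))
        fun s hs => pow_le_pow_left₀ (by positivity) (hge s hs) 2
    rw [intervalIntegral.integral_const, smul_eq_mul] at h1
    linarith
  -- contradiction with the Cauchy window
  have hIt : dist (I (max t 0)) (⨆ T : ℝ, I (max T 0)) < δ * (ε / 2) ^ 2 / 2 := hN t htN'
  have hItδ : dist (I (max (t + δ) 0)) (⨆ T : ℝ, I (max T 0)) < δ * (ε / 2) ^ 2 / 2 :=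
    hN (t + δ) (by linarith)
  rw [max_eq_left ht0] at hIt
  rw [max_eq_left (by linarith : (0 : ℝ) ≤ t + δ)] at hItδ
  have := dist_triangle_right (I (t + δ)) (I t) (⨆ T : ℝ, I (max T 0))
  rw [Real.dist_eq, abs_of_nonneg (by linarith : 0 ≤ I (t + δ) - I t)] at this
  linarith

/-- **Trapped trajectories accumulate at stagnation points (`γ ≠ ½`).**  Under the hypotheses of
`tendsto_transport_comp_of_bounded` there is a point `y` of the nodal set `𝒩_V` (a stagnation point of the
self-similar Lagrangian flow) in the ball `‖y‖ ≤ B` which is a cluster point of `Y(t)` as `t → ∞`.  With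
`σ = −1` (backward trajectories, the bounded ones in the window `γ < ½`): every such trajectory emanates from
the nodal set.  Kill-test form: a recirculation region of `γy + U` whose closure avoids `𝒩_V` is impossible.
[cite: ConstantinIgnatovaVicol2026Putative, §3.4.3 eq. (3.33) and Rem. 3.6] -/
theorem exists_mem_nodalSet_mapClusterPt_of_bounded (h : IsSelfSimilarEulerProfile γ c U P)
    (hγ : γ ≠ 1 / 2) {σ : ℝ} (hσ : σ ≠ 0) {Y : ℝ → EuclideanSpace ℝ (Fin 3)}
    (hY : ∀ t, HasDerivAt Y (σ • selfSimilarTransport γ c U (Y t)) t) {B : ℝ} (hB : ∀ t, 0 ≤ t → ‖Y t‖ ≤ B) :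
    ∃ y ∈ selfSimilarNodalSet γ c U, ‖y‖ ≤ B ∧ MapClusterPt y atTop Y := by
  have hK := isCompact_closedBall (0 : EuclideanSpace ℝ (Fin 3)) B
  have hle : map Y atTop ≤ 𝓟 (closedBall (0 : EuclideanSpace ℝ (Fin 3)) B) := by
    rw [le_principal_iff, mem_map]
    filter_upwards [eventually_ge_atTop (0 : ℝ)] with t ht
    exact mem_closedBall_zero_iff.2 (hB t ht)
  obtain ⟨y, hyK, hy⟩ := hK.exists_clusterPt hle
  refine ⟨y, ?_, mem_closedBall_zero_iff.1 hyK, hy⟩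
  -- `V(y) = 0`: otherwise `‖V‖ > ‖V y‖/2` near `y`, while `V(Y(t)) → 0`
  rw [mem_selfSimilarNodalSet_iff, ← selfSimilarTransport_apply]
  by_contra hne
  have hpos : 0 < ‖selfSimilarTransport γ c U y‖ := norm_pos_iff.2 hne
  have hVc := continuous_transport h
  -- neighbourhood of `y` where the speed is large
  have hW : {z : EuclideanSpace ℝ (Fin 3) | ‖selfSimilarTransport γ c U y‖ / 2 < ‖selfSimilarTransport γ c U z‖}
      ∈ 𝓝 y := by
    refine (isOpen_lt continuous_const hVc.norm).mem_nhds ?_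
    show ‖selfSimilarTransport γ c U y‖ / 2 < ‖selfSimilarTransport γ c U y‖
    linarith
  have hfreq : ∃ᶠ t in atTop, ‖selfSimilarTransport γ c U y‖ / 2 < ‖selfSimilarTransport γ c U (Y t)‖ :=
    (mapClusterPt_iff_frequently.1 hy) _ hW
  have hlim := h.tendsto_transport_comp_of_bounded hγ hσ hY hB
  have hev : ∀ᶠ t in atTop, ‖selfSimilarTransport γ c U (Y t)‖ < ‖selfSimilarTransport γ c U y‖ / 2 := by
    have := (tendsto_zero_iff_norm_tendsto_zero.1 hlim)
    exact this.eventually_lt_const (by linarith)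
  exact (hfreq.and_eventually hev).exists.elim fun t ht => absurd ht.1 (not_lt.2 ht.2.le)

end IsSelfSimilarEulerProfile

end Literature.Analysis.FluidPDE

end
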